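import Summits.CriticalPhenomena.SAWScalingLimit.Theorems.SimpleSubseqLimits.Negative.SimpleSubseqLimitsHonesty
import Mathlib.MeasureTheory.Measure.Portmanteau
import Literature.Probability.RandomPlanarGeometry.CurveSpace
import HarnessLib

/-!
# Limit passage — stub `stub_noMarkedRevisit` of the line `marked-point-revisit`
(crux `SAWLoopFugacityFlow.SimpleSubseqLimits`, stmt-CriticalPhenomena-4982)

The soft step of the line: from the ONE lattice input `NoTouchAt D a b` (small probability, as the
mesh `δ → 0⁺`, of the OPEN polyline event `NearRevisit`) and weak convergence of the critical SAW
laws along `s n → 0⁺` to `ν`, conclude `NoMarkedRevisitFor ν`: `ν`-a.e. curve class has a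
representative with no EXACT revisit of a marked point, for all parameters `(z, ρ, R)` in a dense
set (rational centre `z` and outer radius `R`, arbitrary `ρ`).

Proof.
1. OPENNESS (`isOpen_setOf_nearRevisit`): `{γ | NearRevisit γ z r R₁ R₂ ε}` is open for the
   reparametrisation pseudo-distance — every defining inequality is strict, the two universal
   clauses range over compact parameter intervals (uniform slack by `IsCompact.exists_isMaxOn` /
   `exists_isMinOn`), and a nearby curve has a uniformly close reparametrisation
   (`Curve.exists_dist_reparam_lt`), the order isomorphism transporting the witnessing times.
   Hence `nearRevisitEvent = CurveClass.mk '' {NearRevisit}` is open (`SeparationQuotient.mk` is an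
   open map) and its preimage under `SAW.DomainSAW.curve` is `{NearRevisit (latticeCurve ·)}`
   (open sets are saturated for distance zero).
2. PORTMANTEAU (`measure_image_mk_le_limsup_law`): along the sequence the laws are eventually
   probability measures (honesty, `eventually_isProbabilityMeasure_of_weakLimitAlong`); after a
   shift of the index the pushed-forward laws converge in `ProbabilityMeasure (CurveClass ℂ)`, so
   for the open event `ν E ≤ liminfₙ Pₙ E ≤ limsupₙ Pₙ E ≤ limsup_{δ → 0⁺} P_δ E`
   (`ProbabilityMeasure.le_liminf_measure_open_of_tendsto`, `Tendsto.limsup_comp_le_limsup`).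
3. NULL SET: for rational `(z, r, R)` with `0 < r < R` and `k : ℕ`, `NoTouchAt` with `θ = k⁻¹`
   gives parameters `ε, R₁ < R < R₂` with `ν E_{z,r,R,k} ≤ k⁻¹`; so `⋂ₖ E_{z,r,R,k}` is `ν`-null
   and so is the countable union `N` over the rational data.
4. DETERMINISTIC EMBEDDING: if a representative `γ` of a class outside `N` had a marked
   configuration `MarkedConfig γ z ρ R lam T` (`z`, `R` rational) and `γ t' = γ lam`, `T < t'`,
   then with `m := min_{u ≤ lam} dist (γ u) z ∈ (ρ, R]` and a rational `r ∈ (max ρ 0, m)` the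
   triple `(lam, T, t')` witnesses `NearRevisit γ z r R₁ R₂ ε` for every `R₁ < R < R₂`, `ε > 0`,
   so the class lies in `N` — contradiction.

The predicates below are VERBATIM copies of the shared vocabulary of the line (the registered
skeleton `Cruxes/SimpleSubseqLimits/Lines/marked-point-revisit.lean`), kept in the sub-namespace
`…MarkedPointRevisit.Passage` so that they can never collide with the skeleton's or the sibling
stub files' copies; they agree with those by `Iff.rfl` / `rfl`.
-/

noncomputable section

open MeasureTheory Filter Topology Set Metric
open Literature.Probability.RandomPlanarGeometry Literature.Probability.LatticeModels
open scoped ENNReal NNReal BoundedContinuousFunction unitInterval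

namespace Summit.CriticalPhenomena.SAWScalingLimit.Theorems.SimpleSubseqLimits.MarkedPointRevisit.Passage

open Summit.CriticalPhenomena.SAWScalingLimit.Theorems.SimpleSubseqLimits.Negative
  (WeakLimitAlong eventually_isProbabilityMeasure_of_weakLimitAlong)

/-! ### Vocabulary (verbatim copies) -/

/-- **Marked first-hit configuration** of a curve `γ` at centre `z` and radii `ρ < R`: `T` is the
FIRST hitting time of `closedBall z ρ`, and `lam < T` is an entrance time into `closedBall z R` after
which `γ` stays in that closed ball up to `T`. The MARKED POINT is `γ lam ∈ sphere z R`: a function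
of the past `γ|[0,T]` only, at distance `≥ R - ρ` from the tip `γ T`. Verbatim the vocabulary of the
registered skeleton `Cruxes/SimpleSubseqLimits/Lines/marked-point-revisit.lean` (line
marked-point-revisit of crux stmt-CriticalPhenomena-4982). [folklore] -/
def MarkedConfig (γ : Curve ℂ) (z : ℂ) (ρ R : ℝ) (lam T : I) : Prop :=
  lam < T ∧ γ lam ∈ sphere z R ∧ (∀ u : I, lam ≤ u → u ≤ T → γ u ∈ closedBall z R) ∧
    γ T ∈ closedBall z ρ ∧ ∀ u : I, u < T → γ u ∉ closedBall z ρ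

/-- **Thickened (open) marked-revisit configuration**: times `lam < T < t'` such that at `lam` the
curve is `R₁`-far from `z`, during `[lam, T]` it stays `R₂`-close, at `T` it is `r`-close, before
`lam` it was never `r`-close (so `T` may be taken to be the first `r`-approach), and at `t'` it
returns `ε`-close to the marked point `γ lam`. All inequalities strict and the two universal clauses
range over compact parameter intervals, so the configuration is open for the sup distance and
invariant under increasing reparametrisation. Every `MarkedConfig γ z ρ R lam T` with an exact
revisit `γ t' = γ lam`, `T < t'`, is a `NearRevisit γ z r R₁ R₂ ε` for all `R₁ < R < R₂`, `ε > 0`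
and every `r ∈ (ρ, min_{u ≤ lam} dist (γ u) z)` (a nonempty interval contained in `(ρ, R]`).
Verbatim the vocabulary of the registered skeleton
`Cruxes/SimpleSubseqLimits/Lines/marked-point-revisit.lean` (line marked-point-revisit of crux
stmt-CriticalPhenomena-4982). [folklore] -/
def NearRevisit (γ : Curve ℂ) (z : ℂ) (r R₁ R₂ ε : ℝ) : Prop :=
  ∃ lam T t' : I, lam < T ∧ T < t' ∧ R₁ < dist (γ lam) z ∧
    (∀ u : I, lam ≤ u → u ≤ T → dist (γ u) z < R₂) ∧ dist (γ T) z < r ∧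
    (∀ u : I, u ≤ lam → r < dist (γ u) z) ∧ dist (γ t') (γ lam) < ε

/-- The thickened marked-revisit EVENT on curve classes: some representative is a `NearRevisit`
configuration (an open subset of `CurveClass ℂ`, `isOpen_nearRevisitEvent`). Verbatim the
vocabulary of the registered skeleton `Cruxes/SimpleSubseqLimits/Lines/marked-point-revisit.lean`
(line marked-point-revisit of crux stmt-CriticalPhenomena-4982). [folklore] -/
def nearRevisitEvent (z : ℂ) (r R₁ R₂ ε : ℝ) : Set (CurveClass ℂ) :=
  {c | ∃ γ : Curve ℂ, CurveClass.mk γ = c ∧ NearRevisit γ z r R₁ R₂ ε}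

/-- The polyline of a lattice SAW: the canonical parametrised representative of `γ.curve`
(`SimpleGraph.Walk.toCurve` through the mesh points). Verbatim the vocabulary of the registered
skeleton `Cruxes/SimpleSubseqLimits/Lines/marked-point-revisit.lean` (line marked-point-revisit of
crux stmt-CriticalPhenomena-4982). [folklore] -/
def latticeCurve {Ω : Set ℂ} {δ : ℝ} {u v : Site 2} (γ : SAW.DomainSAW Ω δ u v) : Curve ℂ :=
  ⟨γ.walk.toCurve (meshPoint δ)⟩

/-- The class of the lattice polyline is the SAW's curve class (definitional). [folklore] -/
@[simp] theorem mk_latticeCurve {Ω : Set ℂ} {δ : ℝ} {u v : Site 2} (γ : SAW.DomainSAW Ω δ u v) :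
    CurveClass.mk (latticeCurve γ) = γ.curve := rfl

/-- `ν` is a **subsequential weak limit** of the pushed-forward critical `δℤ²` SAW laws of
`(D; a_δ, b_δ)` along the meshes `s n → 0⁺` — the three antecedents of the crux, verbatim.
Verbatim the vocabulary of the registered skeleton
`Cruxes/SimpleSubseqLimits/Lines/marked-point-revisit.lean` (line marked-point-revisit of crux
stmt-CriticalPhenomena-4982). [folklore] -/
def IsSubseqLimit (D : DobrushinDomain) (a b : ℝ → Site 2) (s : ℕ → ℝ)
    (ν : Measure (CurveClass ℂ)) : Prop :=
  Tendsto s atTop (𝓝[>] (0 : ℝ)) ∧ IsProbabilityMeasure ν ∧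
    ∀ f : CurveClass ℂ →ᵇ ℝ,
      Tendsto (fun n => ∫ γ, f γ.curve ∂(SAW.law D.carrier (s n) (a (s n)) (b (s n)))) atTop
        (𝓝 (∫ x, f x ∂ν))

/-- **No marked revisit under `ν`**: there is a DENSE set `S` of parameters `(z, ρ, R)` such that
`ν`-a.e. class has a representative `γ` which, for every `(z, ρ, R) ∈ S` and every marked first-hit
configuration `(lam, T)`, never returns to the marked point `γ lam` after `T` (the ORDER clause of
the line at the limit level; for `ρ ≥ R` or `ρ < 0` the configuration is empty). Verbatim the
vocabulary of the registered skeleton `Cruxes/SimpleSubseqLimits/Lines/marked-point-revisit.lean`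
(line marked-point-revisit of crux stmt-CriticalPhenomena-4982). [folklore] -/
def NoMarkedRevisitFor (ν : Measure (CurveClass ℂ)) : Prop :=
  ∃ S : Set (ℂ × ℝ × ℝ), Dense S ∧
    ∀ᵐ c ∂ν, ∃ γ : Curve ℂ, CurveClass.mk γ = c ∧
      ∀ p ∈ S, ∀ lam T : I, MarkedConfig γ p.1 p.2.1 p.2.2 lam T →
        ∀ t' : I, T < t' → γ t' ≠ γ lam

/-- **One-point no-touch at `(D; a_δ, b_δ)`** (the line's ONE lattice input, thickened
first-approach form): for the critical SAW law `P_δ = SAW.law D δ (a δ) (b δ)`, every centre `z`,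
radii `0 < r < R` and `θ > 0` there are a return radius `ε > 0` and an annulus `R₁ < R < R₂` beyond
`r` with `limsup_{δ → 0⁺} P_δ[NearRevisit (polyline) z r R₁ R₂ ε] ≤ θ` — at its first `r`-approach
of `z` the walk later comes back `ε`-close to a point of its final approach lying in `A(z; R₁, R₂)`
only with small probability. An unconditional probability of an open polyline event; an
`x_c`-statement (false for `x > x_c`, space-filling limits); implied by the summit conjecture
(nested thickenings of a marked revisit of a weak limit shrink to a double point). Verbatim the
vocabulary of the registered skeleton `Cruxes/SimpleSubseqLimits/Lines/marked-point-revisit.lean`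
(line marked-point-revisit of crux stmt-CriticalPhenomena-4982). [folklore] -/
def NoTouchAt (D : DobrushinDomain) (a b : ℝ → Site 2) : Prop :=
  ∀ (z : ℂ) (r R : ℝ), 0 < r → r < R → ∀ θ : ℝ≥0∞, 0 < θ →
    ∃ ε R₁ R₂ : ℝ, 0 < ε ∧ r < R₁ ∧ R₁ < R ∧ R < R₂ ∧
      limsup (fun δ : ℝ => SAW.law D.carrier δ (a δ) (b δ)
          {γ | NearRevisit (latticeCurve γ) z r R₁ R₂ ε}) (𝓝[>] (0 : ℝ)) ≤ θ

/-! ### Step 1: the thickened event is open -/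

/-- **Openness of the thickened marked-revisit configuration** for the reparametrisation
pseudo-distance on `Curve ℂ`: fix witnessing times `(lam, T, t')` for `γ`; all five clauses have a
positive slack (the two universal ones uniformly, by compactness of `[lam, T]` and `[0, lam]`); a
curve `γ'` at distance `< slack` has a reparametrisation `φ` with `γ' ∘ φ` uniformly close to `γ`
(`Curve.exists_dist_reparam_lt`), and `(φ lam, φ T, φ t')` witnesses the configuration for `γ'`.
[folklore] -/
theorem isOpen_setOf_nearRevisit (z : ℂ) (r R₁ R₂ ε : ℝ) :
    IsOpen {γ : Curve ℂ | NearRevisit γ z r R₁ R₂ ε} := by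
  rw [Metric.isOpen_iff]
  rintro γ ⟨lam, T, t', hlT, hTt, h1, h2, h3, h4, h5⟩
  have hc : Continuous fun u : I => dist (γ u) z := γ.continuous.dist continuous_const
  obtain ⟨u₀, hu₀, hmax⟩ := (isClosed_Icc (a := lam) (b := T)).isCompact.exists_isMaxOn
    (nonempty_Icc.2 hlT.le) hc.continuousOn
  obtain ⟨u₁, hu₁, hmin⟩ := (isClosed_Iic (a := lam)).isCompact.exists_isMinOn
    nonempty_Iic hc.continuousOn
  have ha₂ : 0 < R₂ - dist (γ u₀) z := sub_pos.2 (h2 u₀ hu₀.1 hu₀.2)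
  have ha₄ : 0 < dist (γ u₁) z - r := sub_pos.2 (h4 u₁ hu₁)
  obtain ⟨d, hd0, hd1, hd2, hd3, hd4, hd5⟩ : ∃ d : ℝ, 0 < d ∧ d ≤ dist (γ lam) z - R₁ ∧
      d ≤ R₂ - dist (γ u₀) z ∧ d ≤ r - dist (γ T) z ∧ d ≤ dist (γ u₁) z - r ∧
      d ≤ (ε - dist (γ t') (γ lam)) / 2 :=
    ⟨_, lt_min (lt_min (lt_min (sub_pos.2 h1) ha₂) (lt_min (sub_pos.2 h3) ha₄))
        (half_pos (sub_pos.2 h5)),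
      (min_le_left _ _).trans ((min_le_left _ _).trans (min_le_left _ _)),
      (min_le_left _ _).trans ((min_le_left _ _).trans (min_le_right _ _)),
      (min_le_left _ _).trans ((min_le_right _ _).trans (min_le_left _ _)),
      (min_le_left _ _).trans ((min_le_right _ _).trans (min_le_right _ _)), min_le_right _ _⟩
  refine ⟨d, hd0, fun γ' hγ' => ?_⟩
  rw [Metric.mem_ball, dist_comm] at hγ'
  obtain ⟨φ, hφ⟩ := Curve.exists_dist_reparam_lt hγ'
  have hcl : ∀ u, dist (γ u) (γ' (φ u)) < d := fun u => by
    have h := ContinuousMap.dist_apply_le_dist (f := γ.toContinuousMap)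
      (g := (γ'.reparam φ).toContinuousMap) (x := u)
    simp only [Curve.coe_toContinuousMap, Curve.reparam_apply] at h
    exact h.trans_lt hφ
  have hcl' : ∀ u', dist (γ (φ.symm u')) (γ' u') < d := fun u' => by
    simpa only [OrderIso.apply_symm_apply] using hcl (φ.symm u')
  refine ⟨φ lam, φ T, φ t', φ.lt_iff_lt.2 hlT, φ.lt_iff_lt.2 hTt, ?_, ?_, ?_, ?_, ?_⟩
  · have := dist_triangle (γ lam) (γ' (φ lam)) z
    linarith [hcl lam]
  · intro u' hl hT
    have hm : dist (γ (φ.symm u')) z ≤ dist (γ u₀) z :=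
      (isMaxOn_iff.1 hmax) _ ⟨φ.le_symm_apply.2 hl, φ.symm_apply_le.2 hT⟩
    have := dist_triangle_left (γ' u') z (γ (φ.symm u'))
    linarith [hcl' u']
  · have := dist_triangle_left (γ' (φ T)) z (γ T)
    linarith [hcl T]
  · intro u' hl
    have hm : dist (γ u₁) z ≤ dist (γ (φ.symm u')) z :=
      (isMinOn_iff.1 hmin) _ (φ.symm_apply_le.2 hl)
    have := dist_triangle (γ (φ.symm u')) (γ' u') z
    linarith [hcl' u']
  · have h₁ := dist_triangle_left (γ' (φ t')) (γ' (φ lam)) (γ t')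
    have h₂ := dist_triangle (γ t') (γ lam) (γ' (φ lam))
    linarith [hcl t', hcl lam]

/-- The thickened event is the image of the open configuration set under the quotient map.
[folklore] -/
theorem nearRevisitEvent_eq_image (z : ℂ) (r R₁ R₂ ε : ℝ) :
    nearRevisitEvent z r R₁ R₂ ε = CurveClass.mk '' {γ | NearRevisit γ z r R₁ R₂ ε} :=
  Set.ext fun _ => exists_congr fun _ => and_comm

/-- **The thickened marked-revisit event is open** in `CurveClass ℂ` (`SeparationQuotient.mk` is
an open map). [folklore] -/
theorem isOpen_nearRevisitEvent (z : ℂ) (r R₁ R₂ ε : ℝ) :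
    IsOpen (nearRevisitEvent z r R₁ R₂ ε) := by
  rw [nearRevisitEvent_eq_image]
  exact SeparationQuotient.isOpenMap_mk _ (isOpen_setOf_nearRevisit z r R₁ R₂ ε)

/-- Open sets of curves are saturated: the class of `γ` lies in the image of an open set `U` iff
`γ ∈ U` (distance zero to a member of `U`). [folklore] -/
theorem mk_mem_image_mk_iff {U : Set (Curve ℂ)} (hU : IsOpen U) (γ : Curve ℂ) :
    CurveClass.mk γ ∈ CurveClass.mk '' U ↔ γ ∈ U :=
  ⟨fun ⟨_, hγ', h⟩ => CurveClass.mem_of_isOpen_of_dist_eq_zero hU hγ'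
    (CurveClass.mk_eq_mk_iff_dist_eq_zero.1 h), fun h => ⟨γ, h, rfl⟩⟩

/-- The pushed-forward SAW law of the image of an open set of curves is the law of the polyline
event. [folklore] -/
theorem map_law_image_mk {Ω : Set ℂ} {δ : ℝ} {u v : Site 2} {p : Curve ℂ → Prop}
    (hp : IsOpen {γ | p γ}) :
    (SAW.law Ω δ u v).map (fun γ => γ.curve) (CurveClass.mk '' {γ | p γ}) =
      SAW.law Ω δ u v {γ | p (latticeCurve γ)} := by
  have hE : IsOpen (CurveClass.mk '' {γ | p γ}) := SeparationQuotient.isOpenMap_mk _ hp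
  rw [Measure.map_apply (SAW.DomainSAW.measurable_of_top _) hE.measurableSet]
  congr 1
  ext γ
  exact mk_mem_image_mk_iff hp (latticeCurve γ)

/-! ### Step 2: portmanteau along the sequence and comparison of filters -/

/-- **Portmanteau bound for open polyline events.** If the critical SAW laws along `s n → 0⁺`
converge weakly to the probability measure `ν`, then for an open set `{γ | p γ}` of curves
`ν (mk '' {p}) ≤ limsup_{δ → 0⁺} P_δ {p ∘ latticeCurve}`: shift the index until the laws are
probability measures (honesty), apply the open-set half of the portmanteau theorem in
`ProbabilityMeasure (CurveClass ℂ)`, and compare `limsup` along `map s atTop ≤ 𝓝[>] 0`.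
[cite: BillingsleyCPM1999, Thm. 2.1] -/
theorem measure_image_mk_le_limsup_law {D : DobrushinDomain} {a b : ℝ → Site 2} {s : ℕ → ℝ}
    {ν : Measure (CurveClass ℂ)} [IsProbabilityMeasure ν] (hs : Tendsto s atTop (𝓝[>] (0 : ℝ)))
    (hw : WeakLimitAlong D a b s ν) {p : Curve ℂ → Prop} (hp : IsOpen {γ | p γ}) :
    ν (CurveClass.mk '' {γ | p γ}) ≤
      limsup (fun δ : ℝ => SAW.law D.carrier δ (a δ) (b δ) {γ | p (latticeCurve γ)})
        (𝓝[>] (0 : ℝ)) := by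
  obtain ⟨N, hN⟩ := eventually_atTop.1 (eventually_isProbabilityMeasure_of_weakLimitAlong hw)
  have hP : ∀ n, IsProbabilityMeasure
      (SAW.law D.carrier (s (n + N)) (a (s (n + N))) (b (s (n + N)))) :=
    fun n => (hN _ (N.le_add_left n)).1
  let μs : ℕ → ProbabilityMeasure (CurveClass ℂ) := fun n =>
    ⟨(SAW.law D.carrier (s (n + N)) (a (s (n + N))) (b (s (n + N)))).map (fun γ => γ.curve), by
      haveI := hP n
      exact Measure.isProbabilityMeasure_map (SAW.DomainSAW.measurable_of_top _).aemeasurable⟩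
  let μ : ProbabilityMeasure (CurveClass ℂ) := ⟨ν, inferInstance⟩
  have hlim : Tendsto μs atTop (𝓝 μ) := by
    rw [ProbabilityMeasure.tendsto_iff_forall_integral_tendsto]
    intro f
    refine ((hw f).comp (tendsto_add_atTop_nat N)).congr fun n => ?_
    change ∫ γ, f γ.curve ∂(SAW.law D.carrier (s (n + N)) (a (s (n + N))) (b (s (n + N)))) =
      ∫ x, f x ∂((SAW.law D.carrier (s (n + N)) (a (s (n + N))) (b (s (n + N)))).map
        (fun γ => γ.curve))
    rw [integral_map (SAW.DomainSAW.measurable_of_top _).aemeasurable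
      f.continuous.aestronglyMeasurable]
  have hE : IsOpen (CurveClass.mk '' {γ | p γ}) := SeparationQuotient.isOpenMap_mk _ hp
  calc ν (CurveClass.mk '' {γ | p γ})
      ≤ liminf (fun n => (μs n : Measure (CurveClass ℂ)) (CurveClass.mk '' {γ | p γ})) atTop :=
        ProbabilityMeasure.le_liminf_measure_open_of_tendsto hlim hE
    _ = liminf (fun n => SAW.law D.carrier (s (n + N)) (a (s (n + N))) (b (s (n + N)))
          {γ | p (latticeCurve γ)}) atTop :=
        liminf_congr (Eventually.of_forall fun n => map_law_image_mk hp)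
    _ ≤ limsup (fun n => SAW.law D.carrier (s (n + N)) (a (s (n + N))) (b (s (n + N)))
          {γ | p (latticeCurve γ)}) atTop := liminf_le_limsup
    _ ≤ limsup (fun δ : ℝ => SAW.law D.carrier δ (a δ) (b δ) {γ | p (latticeCurve γ)})
          (𝓝[>] (0 : ℝ)) :=
        (hs.comp (tendsto_add_atTop_nat N)).limsup_comp_le_limsup
          (u := fun δ : ℝ => SAW.law D.carrier δ (a δ) (b δ) {γ | p (latticeCurve γ)})

/-! ### Steps 3–4: the null set and the deterministic embedding -/

/-- **Stub 4 of the line `marked-point-revisit` — LIMIT PASSAGE.** From the one-point no-touch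
bound `NoTouchAt D a b` and weak convergence of the critical SAW laws along `s n → 0⁺` to `ν`,
`ν`-a.e. curve class has a representative without exact marked revisits for all parameters
`(z, ρ, R)` with `z ∈ ℚ + iℚ` and `R ∈ ℚ` (a dense set): the thickened events are open, so by the
portmanteau theorem `ν E ≤ limsup_δ P_δ E ≤ θ`; letting `θ = k⁻¹ → 0` and taking the countable
union over rational data gives a `ν`-null set `N`; and an exact marked revisit of ANY
representative places its class in `N` (choose a rational `r` strictly between `ρ` and
`min_{u ≤ lam} dist (γ u) z ≤ R`). [folklore] -/
theorem stub_noMarkedRevisit :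
    ∀ (D : DobrushinDomain) (a b : ℝ → Site 2) (s : ℕ → ℝ) (ν : Measure (CurveClass ℂ)),
      NoTouchAt D a b → IsSubseqLimit D a b s ν → NoMarkedRevisitFor ν := by
  intro D a b s ν hNT hL
  obtain ⟨hs, hν, hw⟩ := hL
  -- Step 3a: the portmanteau bound on the thickened events, `θ = k⁻¹`.
  have hbound : ∀ (z : ℂ) (r R : ℝ) (k : ℕ), ∃ ε R₁ R₂ : ℝ, 0 < r → r < R →
      0 < ε ∧ R₁ < R ∧ R < R₂ ∧ ν (nearRevisitEvent z r R₁ R₂ ε) ≤ (k : ℝ≥0∞)⁻¹ := by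
    intro z r R k
    by_cases h : 0 < r ∧ r < R
    · obtain ⟨ε, R₁, R₂, hε, -, h₁, h₂, hlim⟩ :=
        hNT z r R h.1 h.2 _ (ENNReal.inv_pos.2 (ENNReal.natCast_ne_top k))
      refine ⟨ε, R₁, R₂, fun _ _ => ⟨hε, h₁, h₂, ?_⟩⟩
      rw [nearRevisitEvent_eq_image]
      exact (measure_image_mk_le_limsup_law hs hw (isOpen_setOf_nearRevisit z r R₁ R₂ ε)).trans
        hlim
    · exact ⟨0, 0, 0, fun hr hrR => (h ⟨hr, hrR⟩).elim⟩
  choose ε R₁ R₂ hb using hbound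
  -- Step 3b: the null set, indexed by rational centres and radii.
  let zq : ℚ × ℚ → ℂ := (⇑Complex.equivRealProdCLM.symm) ∘ Prod.map ((↑) : ℚ → ℝ) ((↑) : ℚ → ℝ)
  let Ev : (ℚ × ℚ) × ℚ × ℚ → ℕ → Set (CurveClass ℂ) := fun q k =>
    nearRevisitEvent (zq q.1) q.2.1 (R₁ (zq q.1) q.2.1 q.2.2 k) (R₂ (zq q.1) q.2.1 q.2.2 k)
      (ε (zq q.1) q.2.1 q.2.2 k)
  let N : Set (CurveClass ℂ) :=
    ⋃ q ∈ {q : (ℚ × ℚ) × ℚ × ℚ | (0 : ℝ) < q.2.1 ∧ (q.2.1 : ℝ) < q.2.2}, ⋂ k, Ev q k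
  have hN : ν N = 0 := by
    refine (measure_biUnion_null_iff (Set.to_countable _)).2 fun q hq => ?_
    by_contra hne
    obtain ⟨k, hk⟩ := ENNReal.exists_inv_nat_lt hne
    exact (not_le.2 hk) ((measure_mono (iInter_subset _ k)).trans (hb _ _ _ k hq.1 hq.2).2.2.2)
  have hae : ∀ᵐ c ∂ν, c ∉ N := measure_eq_zero_iff_ae_notMem.1 hN
  -- Step 4: the dense parameter set and the deterministic embedding.
  have hz : DenseRange zq :=
    Complex.equivRealProdCLM.symm.surjective.denseRange.comp
      (Rat.denseRange_cast.prodMap Rat.denseRange_cast) Complex.equivRealProdCLM.symm.continuous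
  refine ⟨Set.range zq ×ˢ (Set.univ ×ˢ Set.range ((↑) : ℚ → ℝ)),
    Dense.prod hz (dense_univ.prod Rat.denseRange_cast), ?_⟩
  filter_upwards [hae] with c hc
  obtain ⟨γ, rfl⟩ := CurveClass.surjective_mk c
  refine ⟨γ, rfl, ?_⟩
  rintro ⟨z, ρ, R⟩ ⟨⟨qz, hqz⟩, -, ⟨qR, hqR⟩⟩ lam T ⟨hlT, hsph, hball, hT, hfirst⟩ t' hTt heq
  dsimp only at hqz hqR hsph hball hT hfirst
  subst hqz hqR
  have hcont : Continuous fun u : I => dist (γ u) (zq qz) := γ.continuous.dist continuous_const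
  obtain ⟨u₁, hu₁, hmin⟩ := (isClosed_Iic (a := lam)).isCompact.exists_isMinOn
    nonempty_Iic hcont.continuousOn
  have hm : ρ < dist (γ u₁) (zq qz) :=
    not_le.1 fun h => hfirst u₁ (lt_of_le_of_lt hu₁ hlT) (mem_closedBall.2 h)
  have hρ0 : 0 ≤ ρ := dist_nonneg.trans (mem_closedBall.1 hT)
  obtain ⟨r, hr, hrm⟩ := exists_rat_btwn (max_lt hm (hρ0.trans_lt hm))
  have hr0 : (0 : ℝ) < r := (le_max_right _ _).trans_lt hr
  have hρr : ρ < r := (le_max_left _ _).trans_lt hr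
  have hR : dist (γ lam) (zq qz) = qR := mem_sphere.1 hsph
  have hmR : dist (γ u₁) (zq qz) ≤ dist (γ lam) (zq qz) := (isMinOn_iff.1 hmin) lam self_mem_Iic
  have hrR : (r : ℝ) < qR := hrm.trans_le (hR ▸ hmR)
  refine hc (mem_biUnion (show ((qz, r, qR) : (ℚ × ℚ) × ℚ × ℚ) ∈
      {q : (ℚ × ℚ) × ℚ × ℚ | (0 : ℝ) < q.2.1 ∧ (q.2.1 : ℝ) < q.2.2} from ⟨hr0, hrR⟩)
    (mem_iInter.2 fun k => ?_))
  obtain ⟨hεk, hR₁k, hR₂k, -⟩ := hb (zq qz) r qR k hr0 hrR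
  refine ⟨γ, rfl, lam, T, t', hlT, hTt, hR.symm ▸ hR₁k,
    fun u hu huT => (mem_closedBall.1 (hball u hu huT)).trans_lt hR₂k,
    (mem_closedBall.1 hT).trans_lt hρr,
    fun u hu => hrm.trans_le ((isMinOn_iff.1 hmin) u hu), ?_⟩
  rw [heq, dist_self]
  exact hεk

end Summit.CriticalPhenomena.SAWScalingLimit.Theorems.SimpleSubseqLimits.MarkedPointRevisit.Passage

end
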